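import Mathlib.AlgebraicGeometry.Morphisms.Flat
import Mathlib.RingTheory.Flat.FaithfullyFlat.Algebra
import HarnessLib

/-!
# Flatness descends along a flat surjective morphism on the source

If `f : X ⟶ Y` is flat and surjective and `f ≫ g` is flat, then `g : Y ⟶ Z` is flat
(`Flat.of_comp_of_surjective`; EGA IV₂ 2.2.11 (iii) / Stacks Tag 02JZ in the affine form:
for ring maps `A → B → C` with `C` flat over `A` and faithfully flat over `B`, `B` is flat over
`A`, `flat_of_flat_of_faithfullyFlat_right`). The scheme statement is checked on stalks
(Mathlib `Flat.iff_flat_stalkMap`, `Scheme.Hom.stalkMap_comp`), where a flat local homomorphism of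
local rings is faithfully flat (`Module.FaithfullyFlat.of_flat_of_isLocalHom`).

Used for the quotient of an abelian variety `P` by a finite subgroup: `P_L → P/S` is flat
(a quotient by a free finite group action) and `P_L → P` is flat and surjective, so the descended
map `P → P/S` is flat.

## References

* [StacksProject, Tag 02JZ] (composition and flatness; cf. Tag 0584). EGA IV₂, Cor. 2.2.11.
-/

universe u v

open CategoryTheory AlgebraicGeometry TensorProduct

namespace Literature.AlgebraicGeometry.Morphisms

/-! ### The affine statement -/

/-- **Flatness descends along a faithfully flat map on the right.** For ring maps `R → S → T`,
if `T` is flat over `R` and faithfully flat over `S`, then `S` is flat over `R`: for an injective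
`R`-linear `u : N → N'`, the map `S ⊗_R N → S ⊗_R N'` becomes, after the faithfully flat base
change `T ⊗_S -` and the canonical isomorphisms `T ⊗_S (S ⊗_R N) ≅ T ⊗_R N`, the injective map
`T ⊗_R N → T ⊗_R N'`. (Stacks Tag 02JZ; EGA IV₂, 2.2.11.) [cite: StacksProject, Tag 02JZ] -/
theorem flat_of_flat_of_faithfullyFlat_right (R : Type u) (S : Type u) (T : Type u)
    [CommRing R] [CommRing S] [CommRing T] [Algebra R S] [Algebra S T] [Algebra R T]
    [IsScalarTower R S T] [Module.Flat R T] [Module.FaithfullyFlat S T] : Module.Flat R S := by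
  rw [Module.Flat.iff_lTensor_preserves_injective_linearMap]
  intro N N' _ _ _ _ u hu
  -- `u.lTensor S` is the base change `u.baseChange S`, an `S`-linear map
  change Function.Injective (u.baseChange S)
  rw [← Module.FaithfullyFlat.lTensor_injective_iff_injective S T]
  -- compare with `u.baseChange T` through `T ⊗_S (S ⊗_R -) ≅ T ⊗_R -`
  let eN := TensorProduct.AlgebraTensorModule.cancelBaseChange R S T T N
  let eN' := TensorProduct.AlgebraTensorModule.cancelBaseChange R S T T N'
  have hcomm : ∀ z, eN' ((u.baseChange S).lTensor T z) = u.baseChange T (eN z) := by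
    intro z
    induction z using TensorProduct.induction_on with
    | zero => simp
    | add x y hx hy => simp only [map_add, hx, hy]
    | tmul t y =>
      induction y using TensorProduct.induction_on with
      | zero => simp
      | add x y hx hy => simp only [TensorProduct.tmul_add, map_add, hx, hy]
      | tmul s n =>
        simp [eN, eN', TensorProduct.AlgebraTensorModule.cancelBaseChange_tmul,
          LinearMap.baseChange_tmul]
  have hinjT : Function.Injective (u.baseChange T) :=
    Module.Flat.lTensor_preserves_injective_linearMap (M := T) u hu
  intro z z' h
  have h' : u.baseChange T (eN z) = u.baseChange T (eN z') := by
    rw [← hcomm, ← hcomm, h]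
  exact eN.injective (hinjT h')

/-! ### The scheme statement -/

/-- **If `f ≫ g` is flat and `f` is flat and surjective, then `g` is flat** (flatness is local on
the source for the fpqc topology in this weak form). On stalks: for `y = f x`,
`𝒪_{Z, g y} → 𝒪_{Y, y} → 𝒪_{X, x}` with the composite flat and the second map a flat local
homomorphism, hence faithfully flat; so the first map is flat
(`flat_of_flat_of_faithfullyFlat_right`). (Stacks Tag 02JZ; EGA IV₂, Cor. 2.2.11 (iii).)
[cite: StacksProject, Tag 02JZ] -/
theorem Flat.of_comp_of_surjective {X Y Z : Scheme.{u}} (f : X ⟶ Y) (g : Y ⟶ Z)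
    [Flat f] [Surjective f] [Flat (f ≫ g)] : Flat g := by
  refine Flat.of_stalkMap g fun y ↦ ?_
  obtain ⟨x, rfl⟩ := f.surjective y
  -- the three local rings and the two local homomorphisms
  let φ := g.stalkMap (f x)
  let ψ := f.stalkMap x
  have hcomp : (f ≫ g).stalkMap x = φ ≫ ψ := Scheme.Hom.stalkMap_comp f g x
  have hψ : ψ.hom.Flat := Flat.stalkMap f x
  have hφψ : (φ ≫ ψ).hom.Flat := hcomp ▸ Flat.stalkMap (f ≫ g) x
  algebraize [φ.hom, ψ.hom, (φ ≫ ψ).hom]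
  have : IsScalarTower (Z.presheaf.stalk (g (f x))) (Y.presheaf.stalk (f x))
      (X.presheaf.stalk x) := IsScalarTower.of_algebraMap_eq' rfl
  have : IsLocalHom (algebraMap (Y.presheaf.stalk (f x)) (X.presheaf.stalk x)) :=
    inferInstanceAs (IsLocalHom (f.stalkMap x).hom)
  have : Module.FaithfullyFlat (Y.presheaf.stalk (f x)) (X.presheaf.stalk x) :=
    Module.FaithfullyFlat.of_flat_of_isLocalHom
  exact flat_of_flat_of_faithfullyFlat_right (Z.presheaf.stalk (g (f x)))
    (Y.presheaf.stalk (f x)) (X.presheaf.stalk x)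

end Literature.AlgebraicGeometry.Morphisms
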